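import Literature.Computability.AlgebraicComplexity.FSV18CommROABPProofs
import HarnessLib

/-!
# FSV Thm. 43 from Lemma 40: commutative roABPs are hit by the SV generator
# (Forbes–Shpilka–Volk 2018, §5.3, Thm. 43 = ToC Thm. 5.19; [FSS14, Cor. 4.3])

Sibling proofs file of `FSV18SuccinctGenerators.lean` (§5.3), assigned by val-lit lead-np ruling
(14)(b). That file types Thm. 43 (`FSV2018_thm43`: "Let `|𝔽| > nd`. Let `F(X) ∈ 𝔽[X_1, …, X_N]` be
of individual degree `d`, computed by a commutative roABP of width `w`. Then `F ≢ 0` iff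
`F ∘ G^{SSV}_{n,4log(w)+1}(y,z) ≢ 0`", generator form) and its printed ingredients Lemma 40
(`FSV2018_lemma40` = [FSS14, Thm. 4.1], a NAMED FACT), Lemma 41 and Lemma 42 (DISCHARGED by val-lit
t19 in `FSV18CommROABPProofs.lean`: `FSV2018_lemma41_holds`, `FSV2018_lemma42_holds`). Here the
printed proof of Thm. 43 is carried out, so that the theorem hangs on Lemma 40 alone:

`FSV2018_thm43_of_lemma40 : FSV2018_lemma40 → FSV2018_thm43`.

Printed proof (p. 28): "By definition, `F` is the `(1,1)` entry of a matrix polynomial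
`F ∈ 𝔽[X]^{w×w}` computed by a width `w` commutative roABP. By Lemma 40 and Lemma 41, `F` is
support-`log(w²)` rank concentrated at `G^{SSV}_{n,log(w²)+1}(t,s)` over `𝔽(t,s)`. By Lemma 42,
`F(G^{SSV}_{n,log(w²)}(y,z) + G^{SSV}_{n,log(w²)+1}(t,s)) ≢ 0`. By Fact 27, [this sum]
`= G^{SSV}_{n,2log(w²)+1}`." The steps here:

* `isCommROABPMatrix_single_of_isCommROABP` — the "by definition" step made explicit (val-lit
  lead-np ruling (12), kernel-checked there; written def-free here): `IsCommROABP` (SOME width-`w`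
  roABP in EVERY order, FSV's and [FSS14]'s definition) gives, for the corner matrix
  `single 0 0 F`, ONE matrix computed as a full ordered product in every order
  (`IsCommROABPMatrix`, Lemma 40's hypothesis): multiply the first layer by `e = single 0 0 1` on
  the left and the last by `e` on the right.
* `thm43_step_lemma42` — Lemma 42 over `K_f = Frac 𝔽[t,s]` for the base-changed corner family,
  pulled back along the injective `𝔽[t,s] → K_f` (`map_injective`, `map_bind₁`).
* `thm43_step_merge` — Fact 27 (`ssvGenCoeff_add`): an explicit substitution sends
  `F ∘ G^{SSV}_{n,k₀+k₁}` to `F(G^{SSV}_{n,k₀}(y,z) + G^{SSV}_{n,k₁}(t,s))`.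
* Bookkeeping: `k₀ = ⌈log₂ w²⌉`, and the second group gets `k₁ = K - k₀ ≥ k₀ + 1` blocks
  (`⌈log₂ w²⌉ ≤ 2⌈log₂ w⌉`), so that `k₀ + k₁` is exactly the `K = 1 + 4⌈log₂ w⌉` blocks of the
  typed generator; Lemma 41 is typed for `k₁ ≤ 2ⁿ` blocks, and in the remaining corner `k₁ > 2ⁿ` the
  generator has more blocks than the `2ⁿ` coordinates and hits every nonzero polynomial outright
  (`bind₁_ssvGenCoeff_ne_zero_of_two_pow_le`, by Lemma 28 `FSV2018_lemma28_holds`).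
* The printed field-size hypothesis `|𝔽| > nd` (carried by `FSV2018_thm43` as
  `∃ S : Finset F, n·d < |S|`) is not used: it serves the hitting SET of [FSS14], not the generator.

No new statements; no named facts introduced.

## References
* [ForbesShpilkaVolk2018] M. Forbes, A. Shpilka, B. L. Volk, *Succinct hitting sets and barriers to
  proving lower bounds for algebraic circuits*, Theory Comput. 14 (2018), arXiv:1701.05328: Fact 27,
  Lemma 28, Def. 38–39, Lemmas 40–42, Thm. 43 (seq.; = ToC 5.3, 5.4, 5.14–5.19), §5.3 p. 28.
  locator: paper:arxiv-1701.05328 p0020.txt:L26–L58; paper:doi-10-4086-toc-2018-v014a018 p0028.txt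
* [ForbesSaptharishiShpilka2014] M. Forbes, R. Saptharishi, A. Shpilka, *Hitting sets for
  multilinear read-once algebraic branching programs, in any order*, STOC 2014
  (arXiv:1309.5668): Thm. 28 (= Lemma 40), Cor. 30 (= Thm. 43);
  locator: paper:arxiv-1309.5668 p0017–p0018.
-/

noncomputable section

namespace Literature.Computability.AlgebraicComplexity

open MvPolynomial Matrix
open Literature.Barriers.ValiantsHypothesis

section CornerEmbedding

variable {R : Type*} [CommRing R] {w : ℕ}

/-- Left multiplication by `single i₀ i₀ 1` keeps row `i₀` and zeroes the others. [folklore] -/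
private theorem single_one_mul_apply (i₀ : Fin w) (A : Matrix (Fin w) (Fin w) R) (a b : Fin w) :
    (Matrix.single i₀ i₀ (1 : R) * A) a b = if a = i₀ then A a b else 0 := by
  rw [Matrix.mul_apply]
  by_cases ha : a = i₀
  · subst ha
    rw [if_pos rfl, Finset.sum_eq_single a]
    · simp
    · intro c _ hc; simp [Ne.symm hc]
    · intro h; exact absurd (Finset.mem_univ _) h
  · rw [if_neg ha]
    refine Finset.sum_eq_zero fun c _ => ?_
    simp [Ne.symm ha]

/-- Right multiplication by `single i₀ i₀ 1` keeps column `i₀` and zeroes the others. [folklore] -/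
private theorem mul_single_one_apply (i₀ : Fin w) (A : Matrix (Fin w) (Fin w) R) (a b : Fin w) :
    (A * Matrix.single i₀ i₀ (1 : R)) a b = if b = i₀ then A a b else 0 := by
  rw [Matrix.mul_apply]
  by_cases hb : b = i₀
  · subst hb
    rw [if_pos rfl, Finset.sum_eq_single b]
    · simp
    · intro c _ hc; simp [Ne.symm hc]
    · intro h; exact absurd (Finset.mem_univ _) h
  · rw [if_neg hb]
    refine Finset.sum_eq_zero fun c _ => ?_
    simp [Ne.symm hb]

/-- `e * A * e = single i₀ i₀ (A i₀ i₀)` for `e = single i₀ i₀ 1`. [folklore] -/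
private theorem single_mul_mul_single_eq (i₀ : Fin w) (A : Matrix (Fin w) (Fin w) R) :
    Matrix.single i₀ i₀ (1 : R) * A * Matrix.single i₀ i₀ 1 = Matrix.single i₀ i₀ (A i₀ i₀) := by
  ext a b
  rw [mul_single_one_apply, single_one_mul_apply, Matrix.single_apply]
  by_cases ha : a = i₀
  · by_cases hb : b = i₀
    · subst ha; subst hb; simp
    · simp [hb, Ne.symm hb]
  · simp [ha, Ne.symm ha]

/-- Entries of `e * A` / `A * e` (`e = single i₀ i₀ 1`) are entries of `A` or `0`, so they stay
univariate of degree `≤ d` in the layer's variable. [folklore] -/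
private theorem entries_single_mul {F : Type*} [CommRing F] {ι : Type*} {w d : ℕ} (i₀ : Fin w)
    (x : MvPolynomial ι F) (A : Matrix (Fin w) (Fin w) (MvPolynomial ι F))
    (hA : ∀ a b, ∃ p : Polynomial F, p.natDegree ≤ d ∧ A a b = Polynomial.aeval x p) :
    (∀ a b, ∃ p : Polynomial F, p.natDegree ≤ d ∧
        (Matrix.single i₀ i₀ (1 : MvPolynomial ι F) * A) a b = Polynomial.aeval x p) ∧
      (∀ a b, ∃ p : Polynomial F, p.natDegree ≤ d ∧
        (A * Matrix.single i₀ i₀ (1 : MvPolynomial ι F)) a b = Polynomial.aeval x p) := by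
  refine ⟨fun a b => ?_, fun a b => ?_⟩
  · rw [single_one_mul_apply]
    split_ifs
    · exact hA a b
    · exact ⟨0, by simp, by simp⟩
  · rw [mul_single_one_apply]
    split_ifs
    · exact hA a b
    · exact ⟨0, by simp, by simp⟩

/-- **The corner embedding** (the "by definition" step of the printed proof of Thm. 43, made
explicit by val-lit lead-np's ruling (12) and kernel-checked there): if `f` has a width-`w` roABP in
every variable order (`IsCommROABP`, FSV's definition = [FSS14]), then the corner matrix
`Matrix.single i₀ i₀ f` is computed as a full ordered matrix product by width-`w` roABPs in every
order (`IsCommROABPMatrix`, the hypothesis of Lemma 40 = [FSS14, Thm. 28]): multiply the first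
layer by `e = single i₀ i₀ 1` on the left and the last layer by `e` on the right.
[cite: ForbesShpilkaVolk2018, Thm. 43 (seq.) = ToC Thm. 5.19, p. 28 (proof: "By definition,
`F` is the `(1,1)` entry of a matrix polynomial … computed by a width `w` commutative roABP")] -/
theorem isCommROABPMatrix_single_of_isCommROABP {F : Type*} [CommRing F] {ι : Type*} [Nonempty ι]
    {w d : ℕ} {f : MvPolynomial ι F} (hw : 0 < w) (h : IsCommROABP F w d f) :
    IsCommROABPMatrix F w d (Matrix.single (⟨0, hw⟩ : Fin w) ⟨0, hw⟩ f) := by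
  intro N π
  obtain ⟨hw', M, hM, hf⟩ := h N π
  set i₀ : Fin w := ⟨0, hw⟩ with hi₀
  -- `N ≥ 1` since `ι` is nonempty
  obtain ⟨n, rfl⟩ : ∃ n, N = n + 1 := by
    rcases N with _ | n
    · exact (π.symm (Classical.arbitrary ι)).elim0
    · exact ⟨n, rfl⟩
  set e : Matrix (Fin w) (Fin w) (MvPolynomial ι F) := Matrix.single i₀ i₀ 1 with he
  rcases n with _ | n
  · -- one layer: restrict it on both sides
    refine ⟨fun _ => e * M 0 * e, ?_, ?_⟩
    · intro i a b
      have hi : i = 0 := Fin.eq_zero i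
      subst hi
      exact (entries_single_mul i₀ _ _ (entries_single_mul i₀ _ _ (hM 0)).1).2 a b
    · rw [List.ofFn_succ, List.ofFn_zero, List.prod_singleton, he, single_mul_mul_single_eq]
      congr 1
      rw [hf, List.ofFn_succ, List.ofFn_zero, List.prod_singleton]
  · -- `n + 2` layers: first layer multiplied by `e` on the left, last layer on the right
    let M' : Fin (n + 2) → Matrix (Fin w) (Fin w) (MvPolynomial ι F) := fun i =>
      if (i : ℕ) = 0 then e * M i else if (i : ℕ) = n + 1 then M i * e else M i
    refine ⟨M', ?_, ?_⟩
    · intro i a b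
      by_cases h0 : (i : ℕ) = 0
      · have : M' i = e * M i := by simp only [M', if_pos h0]
        rw [this]; exact (entries_single_mul i₀ _ _ (hM i)).1 a b
      · by_cases h1 : (i : ℕ) = n + 1
        · have : M' i = M i * e := by simp only [M', if_neg h0, if_pos h1]
          rw [this]; exact (entries_single_mul i₀ _ _ (hM i)).2 a b
        · have : M' i = M i := by simp only [M', if_neg h0, if_neg h1]
          rw [this]; exact hM i a b
    · have hsplit : ∀ (G : Fin (n + 2) → Matrix (Fin w) (Fin w) (MvPolynomial ι F)),
          List.ofFn G =
            G 0 :: (List.ofFn (fun i : Fin n => G i.castSucc.succ) ++ [G (Fin.last (n + 1))]) := by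
        intro G
        rw [List.ofFn_succ, List.ofFn_succ', List.concat_eq_append, Fin.succ_last]
      have h00 : ((0 : Fin (n + 2)) : ℕ) = 0 := rfl
      have h0' : M' 0 = e * M 0 := by simp only [M', if_pos h00]
      have hl0 : ((Fin.last (n + 1) : Fin (n + 2)) : ℕ) ≠ 0 := by
        rw [Fin.val_last]; exact Nat.succ_ne_zero n
      have hl1 : ((Fin.last (n + 1) : Fin (n + 2)) : ℕ) = n + 1 := Fin.val_last _
      have hlast : M' (Fin.last (n + 1)) = M (Fin.last (n + 1)) * e := by
        simp only [M', if_neg hl0, if_pos hl1]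
      have hmid : (fun i : Fin n => M' i.castSucc.succ) = fun i : Fin n => M i.castSucc.succ := by
        funext i
        have h1 : ((i.castSucc.succ : Fin (n + 2)) : ℕ) ≠ 0 := by
          rw [Fin.val_succ]; exact Nat.succ_ne_zero _
        have h2 : ((i.castSucc.succ : Fin (n + 2)) : ℕ) ≠ n + 1 := by
          rw [Fin.val_succ, Fin.val_castSucc]; have := i.isLt; omega
        simp only [M', if_neg h1, if_neg h2]
      have hprod : (List.ofFn M').prod = e * (List.ofFn M).prod * e := by
        rw [hsplit M', h0', hmid, hlast, hsplit M, List.prod_cons, List.prod_cons,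
          List.prod_append, List.prod_append, List.prod_singleton, List.prod_singleton]
        simp only [mul_assoc]
      rw [hprod, he, single_mul_mul_single_eq, ← hf]


end CornerEmbedding


section Thm43

variable {n : ℕ}

/-- The multilinear exponent vectors embed into `Fin n → Fin 2`. [folklore] -/
private theorem multilinear_bits_injective :
    Function.Injective (fun m : multilinearMonomials n => fun i : Fin n =>
      (⟨(m : Fin n →₀ ℕ) i, Nat.lt_succ_of_le (m.2 i)⟩ : Fin 2)) := by
  intro m m' h
  apply Subtype.ext
  ext i
  have := congrFun h i
  simpa using congrArg Fin.val this

/-- There are finitely many (`≤ 2ⁿ`) multilinear exponent vectors. [folklore] -/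
private theorem finite_multilinearMonomials : Finite (multilinearMonomials n) :=
  Finite.of_injective _ multilinear_bits_injective

/-- At most `2ⁿ` multilinear exponent vectors. [folklore] -/
private theorem card_multilinearMonomials_le [Fintype (multilinearMonomials n)] :
    Fintype.card (multilinearMonomials n) ≤ 2 ^ n :=
  (Fintype.card_le_of_injective _ multilinear_bits_injective).trans (by simp)

/-- `rename` as a `bind₁` (plumbing). [folklore] -/
private theorem rename_eq_bind₁_X {σ τ R : Type*} [CommSemiring R] (g : σ → τ)
    (p : MvPolynomial σ R) : rename g p = bind₁ (fun i => (X (g i) : MvPolynomial τ R)) p := by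
  induction p using MvPolynomial.induction_on with
  | C a => simp
  | add p q hp hq => simp [hp, hq]
  | mul_X p i hp => simp [hp]

/-- Substituting the variables `X v` of a polynomial ring over an `F`-algebra `A` is base change.
[folklore] -/
private theorem aeval_X_eq_map {σ F A : Type*} [CommSemiring F] [CommSemiring A] [Algebra F A]
    (p : MvPolynomial σ F) :
    aeval (fun v => (X v : MvPolynomial σ A)) p = MvPolynomial.map (algebraMap F A) p := by
  induction p using MvPolynomial.induction_on with
  | C a => simp
  | add p q hp hq => simp [hp, hq]
  | mul_X p i hp => simp [hp]

/-- Substituting constants `C (X v)` embeds a polynomial as a constant. [folklore] -/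
private theorem aeval_C_X_eq_C {σ τ F : Type*} [CommSemiring F] (p : MvPolynomial σ F) :
    aeval (fun v => (C (X v) : MvPolynomial τ (MvPolynomial σ F))) p = C p := by
  induction p using MvPolynomial.induction_on with
  | C a => simp
  | add p q hp hq => simp [hp, hq]
  | mul_X p i hp => simp [hp]

/-- `G^{SSV}_{n,k}` has integer coefficients: it is preserved by base change. [folklore] -/
private theorem map_ssvGenCoeff {R S : Type*} [CommRing R] [CommRing S] (ψ : R →+* S) (k : ℕ)
    (m : Fin n →₀ ℕ) : MvPolynomial.map ψ (ssvGenCoeff R n k m) = ssvGenCoeff S n k m := by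
  rw [ssvGenCoeff, ssvGenCoeff, map_sum]
  refine Finset.sum_congr rfl fun j _ => ?_
  rw [map_mul, map_X, map_prod]
  congr 1
  refine Finset.prod_congr rfl fun i _ => ?_
  split_ifs <;> simp

/-- More seed blocks than coordinates: `G^{SSV}_{n,K}` with `K ≥ 2ⁿ` hits every nonzero polynomial
(plant every coordinate on its own block, Lemma 28; the composition then renames `D` injectively).
[cite: ForbesShpilkaVolk2018, Lemma 28 (seq.) = ToC Lemma 5.4, p. 24] -/
private theorem bind₁_ssvGenCoeff_ne_zero_of_two_pow_le {F : Type} [Field F] {K : ℕ}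
    (hK : 2 ^ n ≤ K) {D : MvPolynomial (multilinearMonomials n) F} (hD : D ≠ 0) :
    bind₁ (fun m : multilinearMonomials n => ssvGenCoeff F n K (m : Fin n →₀ ℕ)) D ≠ 0 := by
  classical
  haveI : Finite (multilinearMonomials n) := finite_multilinearMonomials
  haveI : Fintype (multilinearMonomials n) := Fintype.ofFinite _
  obtain ⟨β, keep, e, he, hplant⟩ := FSV2018_lemma28_holds F n K Finset.univ
    (by rw [Finset.card_univ]; exact card_multilinearMonomials_le.trans hK)
  intro h0
  have h1 := congrArg (bind₁ (Sum.elim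
    (fun j => if keep j then (X j : MvPolynomial (Fin K) F) else 0) (fun p => C (β p)))) h0
  rw [map_zero, bind₁_bind₁] at h1
  simp_rw [hplant, dif_pos (Finset.mem_univ _)] at h1
  rw [← rename_eq_bind₁_X] at h1
  refine hD (rename_injective (fun m : multilinearMonomials n => e ⟨m, Finset.mem_univ m⟩) ?_ ?_)
  · intro m m' hmm'
    exact congrArg Subtype.val (he hmm')
  · rw [h1, map_zero]

/-- `ℓ`-wise independence is monotone in `ℓ`. [folklore] -/
private theorem IsIndepMonomialMap.mono {F : Type*} [CommRing F] {ι τ τ' : Type*} {d ℓ ℓ' : ℕ}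
    {g : ι → MvPolynomial (τ ⊕ τ') F} (h : IsIndepMonomialMap F d ℓ g) (hℓ : ℓ' ≤ ℓ) :
    IsIndepMonomialMap F d ℓ' g :=
  fun S hS => h S (hS.trans hℓ)

/-- `⌈log₂ (w²)⌉ ≤ 2⌈log₂ w⌉`. [folklore] -/
private theorem clog_sq_le (w : ℕ) : Nat.clog 2 (w ^ 2) ≤ 2 * Nat.clog 2 w := by
  rw [Nat.clog_le_iff_le_pow one_lt_two, pow_mul']
  exact Nat.pow_le_pow_left (Nat.le_pow_clog one_lt_two w) 2

/-- **Lemma 42 applied to the corner family and pulled back** along an injective base change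
`𝔽[t,s] → K` (print: "over `𝔽(t,s)`"): if the corner family `(single 0 0 D)`, base-changed to `K`,
is support-`k₀` rank concentrated at (the image of) `g`, then
`D(X ↦ G^{SSV}_{n,k₀}(y,z) + g)` — a polynomial in `y, z` over `𝔽[t,s]` — is nonzero.
[cite: ForbesShpilkaVolk2018, Thm. 43 (seq.) = ToC Thm. 5.19, p. 28 (proof, "By Lemma 42")] -/
private theorem thm43_step_lemma42 {F : Type} [Field F] {σ : Type} {n r k₀ : ℕ} (K : Type) [Field K]
    [Algebra (MvPolynomial σ F) K] (hinj : Function.Injective (algebraMap (MvPolynomial σ F) K))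
    (D : MvPolynomial (multilinearMonomials n) F) (hD0 : D ≠ 0)
    (g : multilinearMonomials n → MvPolynomial σ F)
    (hconc : IsRankConcentrated (K := K) k₀
      (fun j : Fin (r + 1) × Fin (r + 1) =>
        MvPolynomial.map ((algebraMap (MvPolynomial σ F) K).comp C)
          (Matrix.single (0 : Fin (r + 1)) (0 : Fin (r + 1)) D j.1 j.2))
      (fun i => algebraMap (MvPolynomial σ F) K (g i))) :
    bind₁ (fun m : multilinearMonomials n =>
        ssvGenCoeff (MvPolynomial σ F) n k₀ (m : Fin n →₀ ℕ) + C (g m))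
      (MvPolynomial.map C D) ≠ 0 := by
  have hC : Function.Injective
      ((algebraMap (MvPolynomial σ F) K).comp (C : F →+* MvPolynomial σ F)) :=
    hinj.comp (C_injective _ _)
  have hFm00 : Matrix.single (0 : Fin (r + 1)) (0 : Fin (r + 1)) D 0 0 = D := by simp
  have h00 : (fun j : Fin (r + 1) × Fin (r + 1) =>
      MvPolynomial.map ((algebraMap (MvPolynomial σ F) K).comp C)
        (Matrix.single (0 : Fin (r + 1)) (0 : Fin (r + 1)) D j.1 j.2)) (0, 0) ≠ 0 := by
    intro h0
    apply hD0
    have h0' : MvPolynomial.map ((algebraMap (MvPolynomial σ F) K).comp C) D = 0 := by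
      simpa [hFm00] using h0
    exact map_injective _ hC (by rw [h0', map_zero])
  have h42 := FSV2018_lemma42_holds K n k₀ r _ _ hconc h00
  intro hQ0
  apply h42
  have : bind₁ (fun m : multilinearMonomials n =>
        ssvGenCoeff K n k₀ (m : Fin n →₀ ℕ) + C (algebraMap (MvPolynomial σ F) K (g m)))
        (MvPolynomial.map ((algebraMap (MvPolynomial σ F) K).comp C)
          (Matrix.single (0 : Fin (r + 1)) (0 : Fin (r + 1)) D (0, 0).1 (0, 0).2)) =
      MvPolynomial.map (algebraMap (MvPolynomial σ F) K) (bind₁ (fun m : multilinearMonomials n =>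
        ssvGenCoeff (MvPolynomial σ F) n k₀ (m : Fin n →₀ ℕ) + C (g m))
          (MvPolynomial.map C D)) := by
    rw [map_bind₁, MvPolynomial.map_map]
    have h1 : Matrix.single (0 : Fin (r + 1)) (0 : Fin (r + 1)) D (0, 0).1 (0, 0).2 = D := hFm00
    rw [h1]
    have hfun : (fun i : multilinearMonomials n =>
        MvPolynomial.map (algebraMap (MvPolynomial σ F) K)
          (ssvGenCoeff (MvPolynomial σ F) n k₀ (i : Fin n →₀ ℕ) + C (g i))) =
        fun m : multilinearMonomials n =>
          ssvGenCoeff K n k₀ (m : Fin n →₀ ℕ) + C (algebraMap (MvPolynomial σ F) K (g m)) := by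
      funext m
      rw [map_add, map_ssvGenCoeff, map_C]
    rw [hfun]
  rw [this, hQ0, map_zero]

/-- **Fact 27 applied: merging the two seed groups.** Substituting, in `D(X ↦ G^{SSV}_{n,k₀+k₁})`,
the first `k₀` seed blocks by the outer variables `y, z` and the last `k₁` blocks by the constants
`t, s ∈ 𝔽[t,s]` yields `D(X ↦ G^{SSV}_{n,k₀}(y,z) + G^{SSV}_{n,k₁}(t,s))` ("by Fact 27,
`G^{SSV}_{n,k₀}(y,z) + G^{SSV}_{n,k₁}(t,s) = G^{SSV}_{n,k₀+k₁}`").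
[cite: ForbesShpilkaVolk2018, Fact 27 and Thm. 43 (seq.) = ToC Fact 5.3 / Thm. 5.19, pp. 23, 28] -/
private theorem thm43_step_merge {F : Type} [Field F] {n k₀ k₁ : ℕ}
    (D : MvPolynomial (multilinearMonomials n) F)
    (h : bind₁ (fun m : multilinearMonomials n =>
        ssvGenCoeff (MvPolynomial (Fin k₁ ⊕ (Fin k₁ × Fin n)) F) n k₀ (m : Fin n →₀ ℕ) +
          C (ssvGenCoeff F n k₁ (m : Fin n →₀ ℕ))) (MvPolynomial.map C D) ≠ 0) :
    bind₁ (fun m : multilinearMonomials n => ssvGenCoeff F n (k₀ + k₁) (m : Fin n →₀ ℕ)) D ≠ 0 := by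
  intro h0
  apply h
  let θ : Fin (k₀ + k₁) ⊕ (Fin (k₀ + k₁) × Fin n) →
      MvPolynomial (Fin k₀ ⊕ (Fin k₀ × Fin n)) (MvPolynomial (Fin k₁ ⊕ (Fin k₁ × Fin n)) F) :=
    Sum.elim (Fin.addCases (fun j => X (Sum.inl j)) (fun j => C (X (Sum.inl j))))
      (fun p => Fin.addCases (fun j => X (Sum.inr (j, p.2)))
        (fun j => C (X (Sum.inr (j, p.2)))) p.1)
  have hθl : θ ∘ svSeedInl n k₀ k₁ = fun v => X v := by
    funext v
    rcases v with j | ⟨j, i⟩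
    · simp [θ, svSeedInl]
    · simp [θ, svSeedInl]
  have hθr : θ ∘ svSeedInr n k₀ k₁ = fun v => C (X v) := by
    funext v
    rcases v with j | ⟨j, i⟩
    · simp [θ, svSeedInr]
    · simp [θ, svSeedInr]
  have hθ : ∀ m : Fin n →₀ ℕ, aeval θ (ssvGenCoeff F n (k₀ + k₁) m) =
      ssvGenCoeff (MvPolynomial (Fin k₁ ⊕ (Fin k₁ × Fin n)) F) n k₀ m +
        C (ssvGenCoeff F n k₁ m) := by
    intro m
    rw [ssvGenCoeff_add, map_add, aeval_rename, aeval_rename, hθl, hθr, aeval_X_eq_map,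
      map_ssvGenCoeff, aeval_C_X_eq_C]
  have hcomp : ∀ D' : MvPolynomial (multilinearMonomials n) F,
      bind₁ (fun m : multilinearMonomials n =>
        ssvGenCoeff (MvPolynomial (Fin k₁ ⊕ (Fin k₁ × Fin n)) F) n k₀ (m : Fin n →₀ ℕ) +
          C (ssvGenCoeff F n k₁ (m : Fin n →₀ ℕ))) (MvPolynomial.map C D') =
      aeval θ (bind₁ (fun m : multilinearMonomials n =>
        ssvGenCoeff F n (k₀ + k₁) (m : Fin n →₀ ℕ)) D') := by
    intro D'
    induction D' using MvPolynomial.induction_on with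
    | C a =>
      rw [map_C, bind₁_C_right, bind₁_C_right, aeval_C]
      rfl
    | add p q hp hq => rw [map_add, map_add, map_add, map_add, hp, hq]
    | mul_X p m hp => rw [map_mul, map_mul, map_X, bind₁_X_right, map_mul, map_mul,
        bind₁_X_right, hp, hθ]
  rw [hcomp, h0, map_zero]

/-- **FSV Thm. 43 (ToC Thm. 5.19) PROVED modulo Lemma 40 [FSS14, Thm. 4.1]** — following the printed
proof: "By definition, `F` is the `(1,1)` entry of a matrix polynomial `F ∈ 𝔽[X]^{w×w}` computed
by a width `w` commutative roABP" (the corner embedding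
`isCommROABPMatrix_single_of_isCommROABP`). "By Lemma 40 and Lemma 41, `F` is support-`log(w²)`
rank concentrated at `G^{SSV}_{n, log(w²)+1}(t, s)` over `𝔽(t, s)`" (`FSV2018_lemma41_holds`, the
hypothesis `h40`, `K_f = FractionRing 𝔽[t,s]`). "By Lemma 42, `F(G^{SSV}_{n,log(w²)}(y,z) + G^{SSV}_{n,log(w²)+1}(t,s)) ≢ 0`" (`FSV2018_lemma42_holds`,
pulled back from `K_f` along the injective base change, `thm43_step_lemma42`). "By Fact 27,
`G^{SSV}_{n,log(w²)}(y,z) + G^{SSV}_{n,log(w²)+1}(t,s) = G^{SSV}_{n,2log(w²)+1}`"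
(`thm43_step_merge`; the second seed group is taken with `K - ⌈log₂ w²⌉ ≥ ⌈log₂ w²⌉ + 1` blocks —
more independence than Lemma 40 asks is harmless — so that the total is exactly the
`K = 1 + 4⌈log₂ w⌉` blocks of the typed generator, using `⌈log₂ w²⌉ ≤ 2⌈log₂ w⌉`). Lemma 41 is typed
for at most `2ⁿ` blocks; in the remaining corner `K - ⌈log₂ w²⌉ ≥ 2ⁿ` the generator has at least as
many blocks as coordinates and hits every nonzero polynomial outright
(`bind₁_ssvGenCoeff_ne_zero_of_two_pow_le`, Lemma 28). The field-size hypothesis `|𝔽| > nd` of the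
printed statement is not used for the GENERATOR statement typed as `FSV2018_thm43` (in [FSS14] it
serves the hitting SET).
[cite: ForbesShpilkaVolk2018, Thm. 43 (seq.) = ToC Thm. 5.19, p. 28] -/
theorem FSV2018_thm43_of_lemma40 (h40 : FSV2018_lemma40) : FSV2018_thm43 := by
  intro F _ n d w _hF D hD hD0
  obtain ⟨hideg, hcomm⟩ := hD
  classical
  by_cases hcase : 2 ^ n ≤ 1 + 4 * Nat.clog 2 w - Nat.clog 2 (w ^ 2)
  · exact bind₁_ssvGenCoeff_ne_zero_of_two_pow_le (hcase.trans (Nat.sub_le _ _)) hD0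
  push Not at hcase
  haveI hfin : Finite (multilinearMonomials n) := finite_multilinearMonomials
  haveI : Fintype (multilinearMonomials n) := Fintype.ofFinite _
  haveI : Nonempty (multilinearMonomials n) := ⟨⟨0, fun i => by simp⟩⟩
  -- `w ≥ 1`: there is an roABP in some order
  obtain ⟨hw, -⟩ := hcomm _ (Fintype.equivFin (multilinearMonomials n)).symm
  obtain ⟨r, rfl⟩ : ∃ r, w = r + 1 := ⟨w - 1, by omega⟩
  -- seed bookkeeping: `k₀ = ⌈log₂ w²⌉`, `k₁ = K - k₀`, `k₀ + k₁ = K = 1 + 4⌈log₂ w⌉`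
  have hsq : Nat.clog 2 ((r + 1) ^ 2) ≤ 2 * Nat.clog 2 (r + 1) := clog_sq_le (r + 1)
  set k₀ := Nat.clog 2 ((r + 1) ^ 2) with hk₀
  set k₁ := 1 + 4 * Nat.clog 2 (r + 1) - k₀ with hk₁
  have hsum : k₀ + k₁ = 1 + 4 * Nat.clog 2 (r + 1) := by omega
  have hk₁n : k₁ ≤ 2 ^ n := hcase.le
  -- the corner matrix, computed by commutative roABPs as a matrix (ruling (12))
  have hFm : IsCommROABPMatrix F (r + 1) d (Matrix.single (0 : Fin (r + 1)) (0 : Fin (r + 1)) D) :=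
    isCommROABPMatrix_single_of_isCommROABP hw hcomm
  have hFdeg : ∀ a b, ∀ m ∈ (Matrix.single (0 : Fin (r + 1)) (0 : Fin (r + 1)) D a b).support,
      ∀ i, m i ≤ d := by
    intro a b m hm i
    by_cases hab : (0 : Fin (r + 1)) = a ∧ (0 : Fin (r + 1)) = b
    · rw [Matrix.single_apply, if_pos hab] at hm
      exact hideg m hm i
    · rw [Matrix.single_apply, if_neg hab, support_zero] at hm
      exact absurd hm (Finset.notMem_empty _)
  -- Lemma 41: `G^{SSV}_{n,k₁}(t,s)` is `(k₀+1)`-wise independent (`k₀ + 1 ≤ k₁ ≤ 2ⁿ`)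
  have hindep : IsIndepMonomialMap F d (k₀ + 1)
      (fun m : multilinearMonomials n => ssvGenCoeff F n k₁ (m : Fin n →₀ ℕ)) :=
    (FSV2018_lemma41_holds F n k₁ d hk₁n).mono (by omega)
  -- Lemma 40: rank concentration over `K_f = Frac 𝔽[t,s]`, then Lemma 42, Fact 27
  have hconc := h40 F (multilinearMonomials n) (Fin k₁) (Fin k₁ × Fin n) (r + 1) d
    (Matrix.single (0 : Fin (r + 1)) (0 : Fin (r + 1)) D)
    (fun m : multilinearMonomials n => ssvGenCoeff F n k₁ (m : Fin n →₀ ℕ)) hFdeg hFm hindep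
  have hmerge := thm43_step_merge D (thm43_step_lemma42
    (FractionRing (MvPolynomial (Fin k₁ ⊕ (Fin k₁ × Fin n)) F))
    (IsFractionRing.injective (MvPolynomial (Fin k₁ ⊕ (Fin k₁ × Fin n)) F) _) D hD0 _ hconc)
  rw [hsum] at hmerge
  exact hmerge

end Thm43

end Literature.Computability.AlgebraicComplexity
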